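import Mathlib
import Summits.KontsevichZagierPeriods.KontsevichZagierPeriods.Theorems.TorsionLogsNeronTorsionSectorStubGridDataAux
import Summits.KontsevichZagierPeriods.KontsevichZagierPeriods.Theorems.TorsionLogsNeronTorsionSectorStubGridDataAux2
import HarnessLib

/-!
# Stub `stub_gridData` — crux `TorsionLogs.NeronTorsionSector`, line `registered` (block U6), III:
# the torsion grid

Auxiliary file for `TorsionLogsNeronTorsionSectorStubGridData.lean`. With the dictionary `hD`
(conclusion of `stub_realDictionary`, verbatim) and an even grid `n = 2m`, `nδ = ω`,
`x k = X(kδ)`, `y k = Y(kδ)`: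

* `gridData_grid_mem`, `gridData_grid_mem_Ioo` — `kδ ∈ (0, ω/2]` for `1 ≤ k ≤ m`, `kδ ∈ (0, ω)`
  for `1 ≤ k < n`;
* `gridData_grid_basic` — `x m = e₁`, `y m = 0`, on-curve, `e₁ ≤ x k`, signs, the reflection
  `x (n − k) = x k`, `y (n − k) = −y k`, strict decrease on `1..m`;
* `gridData_grid_chord` — `y k + y 1 ≠ 0` and the chord law in regular form along the grid
  (`1 ≤ k ≤ n − 2`; `y k + y 1 = 0` would force `f(x k) = f(x 1)`, `x k = x 1`, `k ∈ {1, n − 1}`);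
* `gridData_grid_alg` — algebraicity of all grid points from that of `P₁ = (x 1, y 1)` (induction
  on the chord recursion);
* `gridData_alg_delta` — algebraicity of `P₁` for `δ = ω/(8N′)`: Bezout (`a′i ≡ 1 mod N′`) makes
  `X(ω/N′)` a coordinate of a multiple of `P = (x_P, y_P)`, `u_P = a′ω/N′`; then three halvings.

References: D. F. Lawden, *Elliptic Functions and Applications* (1989), §6.7–6.8;
J. H. Silverman, *The Arithmetic of Elliptic Curves* (2009), III.2.3.
-/

noncomputable section

-- `Summit.KontsevichZagierPeriods.KontsevichZagierPeriods.…` is the tree's mandated layout (single-conjunct summit).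
set_option linter.dupNamespace false

open Set

namespace Summit.KontsevichZagierPeriods.KontsevichZagierPeriods.Cruxes.NeronTorsionSector.Translation

/-! ### Grid arguments -/

/-- On an even grid `n = 2m`, `nδ = ω > 0`: `kδ ∈ (0, ω/2]` for `1 ≤ k ≤ m`. [folklore] -/
theorem gridData_grid_mem : ∀ {ω δ : ℝ} {n m k : ℕ}, n = 2 * m → (n : ℝ) * δ = ω → 0 < ω →
    1 ≤ k → k ≤ m → (k : ℝ) * δ ∈ Set.Ioc 0 (ω / 2) := by
  intro ω δ n m k hnm hnδ hω hk hkm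
  subst hnm
  push_cast at hnδ
  have hm : (0 : ℝ) < m := by
    rcases Nat.eq_zero_or_pos m with rfl | h
    · simp at hnδ; linarith
    · exact_mod_cast h
  have hδ : 0 < δ := by nlinarith
  have hk' : (1 : ℝ) ≤ k := by exact_mod_cast hk
  have hkm' : (k : ℝ) ≤ m := by exact_mod_cast hkm
  exact ⟨by positivity, by nlinarith⟩

/-- On an even grid `n = 2m`, `nδ = ω > 0`: `kδ ∈ (0, ω)` for `1 ≤ k < n`. [folklore] -/
theorem gridData_grid_mem_Ioo {ω δ : ℝ} {n k : ℕ} (hnδ : (n : ℝ) * δ = ω) (hω : 0 < ω)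
    (hk : 1 ≤ k) (hkn : k < n) : (k : ℝ) * δ ∈ Set.Ioo 0 ω := by
  have hn : (0 : ℝ) < n := by exact_mod_cast lt_of_le_of_lt (Nat.zero_le k) hkn
  have hδ : 0 < δ := by nlinarith
  have hk' : (1 : ℝ) ≤ k := by exact_mod_cast hk
  have hkn' : (k : ℝ) < n := by exact_mod_cast hkn
  exact ⟨by positivity, by nlinarith⟩

section Dictionary

variable {g₂ g₃ e₁ ω : ℝ} {f X Y : ℝ → ℝ}
  (hf : ∀ x, f x = 4 * x ^ 3 - g₂ * x - g₃)
  (hD : 0 < ω ∧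
      ω = 2 * ∫ x in Set.Ioi e₁, (Real.sqrt (f x))⁻¹ ∧
      (∀ u, X (u + ω) = X u) ∧ (∀ u, X (-u) = X u) ∧ (∀ u, Y (u + ω) = Y u) ∧ (∀ u, Y (-u) = -Y u) ∧
      X (ω / 2) = e₁ ∧ Y (ω / 2) = 0 ∧
      (∀ u ∈ Set.Ioo 0 ω, u ≠ ω / 2 → e₁ < X u) ∧
      (∀ u ∈ Set.Ioo 0 ω, Y u ^ 2 = f (X u)) ∧
      (∀ u ∈ Set.Ioo 0 (ω / 2), Y u < 0) ∧
      StrictAntiOn X (Set.Ioc 0 (ω / 2)) ∧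
      (∀ x, e₁ < x → ∃ u ∈ Set.Ioo 0 (ω / 2), X u = x) ∧
      (∀ u ∈ Set.Ioc 0 (ω / 2), ∫ x in Set.Ioi (X u), (Real.sqrt (f x))⁻¹ = u) ∧
      (∀ u ∈ Set.Ioo 0 ω, HasDerivAt X (Y u) u ∧ HasDerivAt Y (6 * X u ^ 2 - g₂ / 2) u) ∧
      (∀ u ∈ Set.Ioo 0 ω, ∀ v ∈ Set.Ioo 0 ω, u + v ≠ ω → X u ≠ X v →
        X (u + v) = ((Y u - Y v) / (X u - X v)) ^ 2 / 4 - X u - X v ∧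
        Y (u + v) = -(Y u + (Y u - Y v) / (X u - X v) * (X (u + v) - X u))) ∧
      (∀ u ∈ Set.Ioo 0 ω, u ≠ ω / 2 →
        X (2 * u) = ((6 * X u ^ 2 - g₂ / 2) / Y u) ^ 2 / 4 - 2 * X u ∧
        Y (2 * u) = -(Y u + (6 * X u ^ 2 - g₂ / 2) / Y u * (X (2 * u) - X u))) ∧
      (∀ u ∈ Set.Ioo 0 ω, ∀ v ∈ Set.Ioo 0 ω, X u = X v ↔ (u = v ∨ u + v = ω)))


section Grid

variable {δ : ℝ} {n m : ℕ} {x y : ℕ → ℝ}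
  (hnm : n = 2 * m) (hm : 2 ≤ m) (hnδ : (n : ℝ) * δ = ω)
  (hx : ∀ k, x k = X (k * δ)) (hy : ∀ k, y k = Y (k * δ))

include hD hnm hm hnδ hx hy in
/-- **Grid facts read off the dictionary**: `x m = e₁`, `y m = 0`; `y k² = f(x k)` and
`e₁ ≤ x k` (`1 ≤ k < n`); `e₁ < x k`, `y k < 0` (`1 ≤ k < m`); the reflection
`x (n − k) = x k`, `y (n − k) = −y k` (evenness/oddness and periodicity); strict decrease of
`x` on `1..m` (`X` is strictly decreasing on `(0, ω/2]`). [cite: Lawden1989, §6.7–6.8] -/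
theorem gridData_grid_basic :
    x m = e₁ ∧ y m = 0 ∧
    (∀ k, 1 ≤ k → k < n → y k ^ 2 = f (x k) ∧ e₁ ≤ x k) ∧
    (∀ k, 1 ≤ k → k < m → e₁ < x k ∧ y k < 0) ∧
    (∀ k, 1 ≤ k → k < n → x (n - k) = x k ∧ y (n - k) = -y k) ∧
    (∀ k, 1 ≤ k → k < m → x (k + 1) < x k) := by
  obtain ⟨hω, -, hXper, hXev, hYper, hYodd, hXh, hYh, hXgt, hYsq, hYneg, hanti, -, -, -, -, -, -⟩ :=
    id hD
  have hmem : ∀ k, 1 ≤ k → k ≤ m → (k : ℝ) * δ ∈ Ioc 0 (ω / 2) :=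
    fun k hk hkm => gridData_grid_mem hnm hnδ hω hk hkm
  have hmδ : (m : ℝ) * δ = ω / 2 := by
    rw [← hnδ, hnm]
    push_cast
    ring
  have hδ : 0 < δ := by
    have := (hmem m (by omega) le_rfl).1
    have hm' : (0 : ℝ) < m := by exact_mod_cast (by omega : 0 < m)
    nlinarith
  have hlt : ∀ k, k < m → (k : ℝ) * δ < ω / 2 := by
    intro k hk
    rw [← hmδ]
    exact mul_lt_mul_of_pos_right (by exact_mod_cast hk) hδ
  refine ⟨by rw [hx, hmδ, hXh], by rw [hy, hmδ, hYh], ?_, ?_, ?_, ?_⟩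
  · intro k hk hkn
    have hk' := gridData_grid_mem_Ioo hnδ hω hk hkn
    refine ⟨by rw [hx, hy]; exact hYsq _ hk', ?_⟩
    rw [hx]
    by_cases hkm : (k : ℝ) * δ = ω / 2
    · rw [hkm, hXh]
    · exact (hXgt _ hk' hkm).le
  · intro k hk hkm
    have hk' := gridData_grid_mem_Ioo hnδ hω hk (by omega)
    rw [hx, hy]
    exact ⟨hXgt _ hk' (hlt k hkm).ne, hYneg _ ⟨hk'.1, hlt k hkm⟩⟩
  · intro k hk hkn
    have e : ((n - k : ℕ) : ℝ) * δ = -((k : ℝ) * δ) + ω := by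
      rw [Nat.cast_sub hkn.le, sub_mul, hnδ]
      ring
    rw [hx, hx, hy, hy, e, hXper, hXev, hYper, hYodd]
    exact ⟨rfl, rfl⟩
  · intro k hk hkm
    rw [hx, hx]
    refine hanti (hmem k hk (by omega)) (hmem (k + 1) (by omega) (by omega)) ?_
    push_cast
    linarith

include hf hD hnm hm hnδ hx hy in
/-- **The chord law along the grid, regular form.** For `1 ≤ k ≤ n − 2`: `y k + y 1 ≠ 0`
(otherwise `f(x k) = (y k)² = (y 1)² = f(x 1)`, so `x k = x 1` by strict monotonicity of `f` on
`[e₁, ∞)`, i.e. `kδ ≡ ±δ`, i.e. `k ∈ {1, n − 1}`; `k = 1` would give `y 1 = 0`), and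
`(x (k+1), y (k+1)) = (x k, y k) ⊕ P₁` in the regular chord form with slope `M(x k)/(y k + y 1)`.
[cite: SilvermanAEC2009, III.2.3] -/
theorem gridData_grid_chord (he : f e₁ = 0) (he0 : 0 < e₁) (hpos : ∀ x, e₁ < x → 0 < f x) :
    ∀ k, 1 ≤ k → k + 1 < n → y k + y 1 ≠ 0 ∧
      x (k + 1) = ((4 * x k ^ 2 + 4 * x k * x 1 + 4 * x 1 ^ 2 - g₂) / (y k + y 1)) ^ 2 / 4
        - x k - x 1 ∧
      y (k + 1) = -(y k + (4 * x k ^ 2 + 4 * x k * x 1 + 4 * x 1 ^ 2 - g₂) / (y k + y 1) *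
        (x (k + 1) - x k)) := by
  obtain ⟨hω, -, -, -, -, -, hXh, -, hXgt, hYsq, hYneg, -, -, -, -, -, -, hiff⟩ := id hD
  have hmδ : (m : ℝ) * δ = ω / 2 := by
    rw [← hnδ, hnm]
    push_cast
    ring
  have hδD : δ ∈ Ioo 0 (ω / 2) := by
    have h1 := gridData_grid_mem (k := 1) hnm hnδ hω le_rfl (by omega)
    rw [Nat.cast_one, one_mul] at h1
    refine ⟨h1.1, lt_of_lt_of_le ?_ (le_of_eq hmδ)⟩
    have hm' : (1 : ℝ) < m := by exact_mod_cast (by omega : 1 < m)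
    nlinarith [h1.1]
  have hδω : δ ∈ Ioo 0 ω := ⟨hδD.1, by linarith [hδD.2]⟩
  -- `e₁ ≤ X u` on `(0, ω)`
  have hXge : ∀ u ∈ Ioo 0 ω, e₁ ≤ X u := by
    intro u hu
    by_cases h : u = ω / 2
    · rw [h, hXh]
    · exact (hXgt u hu h).le
  -- `f` is injective on `[e₁, ∞)`
  have hfinj : ∀ s t, e₁ ≤ s → e₁ ≤ t → f s = f t → s = t := by
    intro s t hs ht hst
    rcases lt_trichotomy s t with h | h | h
    · exact absurd hst (gridData_cubic_lt hf he he0 hpos hs h).ne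
    · exact h
    · exact absurd hst.symm (gridData_cubic_lt hf he he0 hpos ht h).ne
  intro k hk hkn
  have hkω : (k : ℝ) * δ ∈ Ioo 0 ω := gridData_grid_mem_Ioo hnδ hω hk (by omega)
  have hsum : (k : ℝ) * δ + δ ≠ ω := by
    intro h
    have h' : ((k + 1 : ℕ) : ℝ) * δ = (n : ℝ) * δ := by rw [hnδ, ← h]; push_cast; ring
    have h'' : ((k + 1 : ℕ) : ℝ) = n := mul_right_cancel₀ hδD.1.ne' h'
    exact absurd (by exact_mod_cast h'' : k + 1 = n) hkn.ne
  have hne : Y ((k : ℝ) * δ) + Y δ ≠ 0 := by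
    intro h0
    have hsq : Y ((k : ℝ) * δ) ^ 2 = Y δ ^ 2 := by
      rw [show Y ((k : ℝ) * δ) = -Y δ by linarith]
      ring
    rw [hYsq _ hkω, hYsq _ hδω] at hsq
    have hX : X ((k : ℝ) * δ) = X δ := hfinj _ _ (hXge _ hkω) (hXge _ hδω) hsq
    rcases (hiff _ hkω _ hδω).1 hX with h1 | h1
    · -- `k = 1`: then `2 Y δ = 0`
      rw [h1] at h0
      linarith [hYneg δ hδD]
    · exact hsum h1
  have e1 : x 1 = X δ := by rw [hx, Nat.cast_one, one_mul]
  have e2 : y 1 = Y δ := by rw [hy, Nat.cast_one, one_mul]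
  have e3 : x (k + 1) = X ((k : ℝ) * δ + δ) := by rw [hx]; push_cast; ring_nf
  have e4 : y (k + 1) = Y ((k : ℝ) * δ + δ) := by rw [hy]; push_cast; ring_nf
  rw [e1, e2, e3, e4, hx k, hy k]
  exact ⟨hne, gridData_regular_chord hf hD hkω hδD hsum hne⟩

/-- **All grid points are algebraic** once `P₁ = (x 1, y 1)` and `g₂` are: the regular chord
recursion expresses `(x (k+1), y (k+1))` rationally in `x k, y k, x 1, y 1, g₂`.
[cite: SilvermanAEC2009, III.2.3] -/
theorem gridData_grid_alg (hg₂ : IsAlgebraic ℚ g₂) (h1x : IsAlgebraic ℚ (x 1))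
    (h1y : IsAlgebraic ℚ (y 1))
    (hchord : ∀ k, 1 ≤ k → k + 1 < n → y k + y 1 ≠ 0 ∧
      x (k + 1) = ((4 * x k ^ 2 + 4 * x k * x 1 + 4 * x 1 ^ 2 - g₂) / (y k + y 1)) ^ 2 / 4
        - x k - x 1 ∧
      y (k + 1) = -(y k + (4 * x k ^ 2 + 4 * x k * x 1 + 4 * x 1 ^ 2 - g₂) / (y k + y 1) *
        (x (k + 1) - x k))) :
    ∀ k, 1 ≤ k → k < n → IsAlgebraic ℚ (x k) ∧ IsAlgebraic ℚ (y k) := by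
  rw [← mem_algebraicClosure_iff] at hg₂ h1x h1y
  intro k hk hkn
  rw [← mem_algebraicClosure_iff, ← mem_algebraicClosure_iff]
  induction k with
  | zero => exact absurd hk (by norm_num)
  | succ k ih =>
    rcases Nat.eq_zero_or_pos k with rfl | hkpos
    · exact ⟨h1x, h1y⟩
    · obtain ⟨ihx, ihy⟩ := ih hkpos (by omega)
      obtain ⟨-, hxk, hyk⟩ := hchord k hkpos hkn
      have hx' : x (k + 1) ∈ algebraicClosure ℚ ℝ := by
        rw [hxk]
        apply_rules only [hg₂, h1x, h1y, ihx, ihy, add_mem, sub_mem, neg_mem, pow_mem, div_mem,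
          inv_mem, mul_mem, ofNat_mem, one_mem, zero_mem]
      refine ⟨hx', ?_⟩
      rw [hyk]
      apply_rules only [hg₂, h1x, h1y, ihx, ihy, hx', add_mem, sub_mem, neg_mem, pow_mem, div_mem,
        inv_mem, mul_mem, ofNat_mem, one_mem, zero_mem]

end Grid

include hf hD in
/-- **`P₁ = (X δ, Y δ)` is algebraic for `δ = ω/(8N′)`.** With `u_P = a′ω/N′` (`a′, N′` coprime,
`0 < 2a′ < N′`) of algebraic coordinates: Bezout gives `i < N′` with `a′i ≡ 1 (mod N′)`, so
`X(ω/N′), Y(ω/N′)` are coordinates of the multiple `i·P` (`gridData_alg_multiples`); three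
halvings (`gridData_alg_half`, inside `(0, ω/2)` since `N′ ≥ 3`) reach `ω/(8N′)`.
[cite: SilvermanAEC2009, III.2.3] -/
theorem gridData_alg_delta (hg₂ : IsAlgebraic ℚ g₂) (hg₃ : IsAlgebraic ℚ g₃) {a' N' : ℕ}
    (ha' : 0 < a') (h2a' : 2 * a' < N') (hcop : Nat.Coprime a' N')
    (hXP : IsAlgebraic ℚ (X ((a' : ℝ) * (ω / N'))))
    (hYP : IsAlgebraic ℚ (Y ((a' : ℝ) * (ω / N')))) :
    IsAlgebraic ℚ (X (ω / (8 * N'))) ∧ IsAlgebraic ℚ (Y (ω / (8 * N'))) := by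
  have hω : 0 < ω := hD.1
  have hN' : 1 < N' := by omega
  have hN'r : (3 : ℝ) ≤ N' := by exact_mod_cast (by omega : 3 ≤ N')
  obtain ⟨i, hiN, hi⟩ := Nat.exists_mul_mod_eq_one_of_coprime hcop hN'
  have hi1 : 1 ≤ i := by
    rcases Nat.eq_zero_or_pos i with rfl | h
    · simp at hi
    · exact h
  have hmul := gridData_alg_multiples hD hg₂ ha' (by omega) hcop hXP hYP i hi1 hiN
  rw [hi, Nat.cast_one, one_mul] at hmul
  -- three halvings
  have hv : ∀ c : ℝ, 2 ≤ c → ω / (c * N') ∈ Ioo 0 (ω / 2) := by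
    intro c hc
    refine ⟨by positivity, div_lt_div_of_pos_left hω (by norm_num) (by nlinarith)⟩
  have h1 : ω / N' = 2 * (ω / (2 * N')) := by
    field_simp
  obtain ⟨hX2, -⟩ := gridData_alg_half hf hD hg₂ hg₃ (hv 2 le_rfl) (by rw [← h1]; exact hmul.1)
  have h2 : ω / (2 * N') = 2 * (ω / (4 * N')) := by
    field_simp
    ring
  obtain ⟨hX4, -⟩ :=
    gridData_alg_half hf hD hg₂ hg₃ (hv 4 (by norm_num)) (by rw [← h2]; exact hX2)
  have h3 : ω / (4 * N') = 2 * (ω / (8 * N')) := by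
    field_simp
    ring
  exact gridData_alg_half hf hD hg₂ hg₃ (hv 8 (by norm_num)) (by rw [← h3]; exact hX4)

end Dictionary

end Summit.KontsevichZagierPeriods.KontsevichZagierPeriods.Cruxes.NeronTorsionSector.Translation
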